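import Summits.ResolutionOfSingularities.ResolutionOfSingularities.Theses.FrobeniusClosing

/-!
# `NoPeriodicIsolatedAtom` (crux stmt-ResolutionOfSingularities-16344, route `FrobeniusClosing`):
# the isolatedness hypothesis `Isol` is load-bearing — WITHOUT it the statement is FALSE
# (negative-side support, refuter crux-attack seat; this file does NOT refute the crux)

The crux says: over every field algebraic over `𝔽_p`, no run `c₀, …, c_r` (`r ≥ 1`) of the
point-blow-up dynamics of a height-one atom `z^p = a(u)` all of whose states are ISOLATED (`Isol`)
of MULTIPLICITY `p` (`MultP`) returns to an isomorphic pair (`¬ PairIso c₀ c_r`).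

Here we record, sorry-free, that `Isol` cannot be dropped: the Whitney-umbrella atom
`z² = x²·y` over `𝔽₂` (`p = 2`, `n = 2`, non-isolated: singular along the `y`-axis) is a LITERAL
FIXED POINT of one step of the dynamics (chart `y`, translation `0`): blowing up the origin in the
`y`-chart gives `x²y³`, dividing by `y²` gives back `x²y`; it has multiplicity `2` at every stage, and
`PairIso c c` holds trivially (`φ = id`, `v = 1`, `g = 0`). So the `Isol`-free version of the crux
fails at `(p, n, κ, r) = (2, 2, 𝔽₂, 1)` — exactly Hauser–Perlega's remark that NON-isolated
(unforced) eternal runs are cheap; the content of the crux is entirely in the isolated regime.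

The dynamics used is the crux's own `let`-block: the thirteen `let`-bound operators are mirrored
below as `def`s (verbatim, as in the BC3 skeleton `Cruxes/NoPeriodicIsolatedAtom/Lines/birth.lean`),
`crux_iff : NoPeriodicIsolatedAtom ↔ … := Iff.rfl` certifies that the mirror is EXACT, and the refuted
proposition is the right-hand side of `crux_iff` with the isolatedness conjunct deleted and nothing
else changed (stated inline; no proposition is defined under `Summits/`).
-/

noncomputable section

-- single-problem summit: the doubled namespace component `ResolutionOfSingularities` is forced by the tree layout
set_option linter.dupNamespace false

namespace Summit.ResolutionOfSingularities.ResolutionOfSingularities.Theorems.NoPeriodicIsolatedAtom.Negative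

open Summit.ResolutionOfSingularities.ResolutionOfSingularities.Theses.FrobeniusClosing (NoPeriodicIsolatedAtom)
open scoped BigOperators Classical

/-! ## The crux's dynamics, mirrored verbatim as `def`s (`p` = the prime; states `(Fin n → ℕ) → κ`) -/

/-- `p`-cleaning: delete the monomials all of whose exponents are divisible by `p`. Mirror of the
crux's `clean`. [cite: HauserPerlega2019, §2] -/
def clean (p : ℕ) {n : ℕ} {κ : Type} [Field κ] (c : (Fin n → ℕ) → κ) : (Fin n → ℕ) → κ :=
  fun A => @ite κ (∀ j, p ∣ A j) (Classical.dec _) 0 (c A)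

/-- Total transform under the chart-`i` point blow-up `u_j ↦ u_i u_j (j ≠ i)`. Mirror of the crux's
`bl`. [cite: HauserPerlega2019, §2] -/
def bl {n : ℕ} {κ : Type} [Field κ] (i : Fin n) (c : (Fin n → ℕ) → κ) : (Fin n → ℕ) → κ :=
  fun B => @ite κ (Finset.sum (Finset.univ.erase i) (fun j => B j) ≤ B i) (Classical.dec _) (c (Function.update B i (B i - Finset.sum (Finset.univ.erase i) (fun j => B j)))) 0

/-- Order (least total degree of a non-zero coefficient; junk `0` at `0`). Mirror of the crux's
`ord`. [folklore] -/
def ord {n : ℕ} {κ : Type} [Field κ] (c : (Fin n → ℕ) → κ) : ℕ :=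
  sInf {m : ℕ | ∃ A, c A ≠ 0 ∧ m = Finset.sum Finset.univ (fun j => A j)}

/-- Division by `u_i ^ s`. Mirror of the crux's `dv`. [folklore] -/
def dv {n : ℕ} {κ : Type} [Field κ] (i : Fin n) (s : ℕ) (c : (Fin n → ℕ) → κ) : (Fin n → ℕ) → κ :=
  fun B => c (Function.update B i (B i + s))

/-- Translation `u_j ↦ u_j + τ_j (j ≠ i)`. Mirror of the crux's `tr`. [folklore] -/
def tr {n : ℕ} {κ : Type} [Field κ] (i : Fin n) (τ : Fin n → κ) (s : ℕ) (c : (Fin n → ℕ) → κ) : (Fin n → ℕ) → κ :=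
  fun B => Finset.sum (Fintype.piFinset (fun _ : Fin n => Finset.range (B i + s + 1))) (fun D => @ite κ (D i = 0) (Classical.dec _) (c (B + D) * Finset.prod (Finset.univ.erase i) (fun j => ((Nat.choose (B j + D j) (B j) : ℕ) : κ) * τ j ^ (D j))) 0)

/-- One step of the point-blow-up dynamics. Mirror of the crux's `step`. [cite: HauserPerlega2019, §2] -/
def step (p : ℕ) {n : ℕ} {κ : Type} [Field κ] (i : Fin n) (τ : Fin n → κ) (c : (Fin n → ℕ) → κ) : (Fin n → ℕ) → κ :=
  clean p (tr i τ (@ite ℕ (p ≤ ord (clean p c)) (Classical.dec _) p 0) (dv i (@ite ℕ (p ≤ ord (clean p c)) (Classical.dec _) p 0) (bl i (clean p c))))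

/-- The run. Mirror of the crux's `run`. [folklore] -/
def run (p : ℕ) {n : ℕ} {κ : Type} [Field κ] (c₀ : (Fin n → ℕ) → κ) (i : ℕ → Fin n) (t : ℕ → Fin n → κ) (m : ℕ) : (Fin n → ℕ) → κ :=
  @Nat.rec (fun _ => (Fin n → ℕ) → κ) c₀ (fun m c => step p (i m) (t m) c) m

/-- The cleaned state as a power series. Mirror of the crux's `ser`. [folklore] -/
def ser (p : ℕ) {n : ℕ} {κ : Type} [Field κ] (c : (Fin n → ℕ) → κ) : MvPowerSeries (Fin n) κ :=
  show MvPowerSeries (Fin n) κ from fun A : Fin n →₀ ℕ => clean p c ⇑A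

/-- Formal partial derivative. Mirror of the crux's `pd`. [folklore] -/
def pd {n : ℕ} {κ : Type} [Field κ] (i : Fin n) (f : MvPowerSeries (Fin n) κ) : MvPowerSeries (Fin n) κ :=
  show MvPowerSeries (Fin n) κ from fun A : Fin n →₀ ℕ => ((A i + 1 : ℕ) : κ) * f (A + Finsupp.single i 1)

/-- Jacobian ideal of the cleaned state. Mirror of the crux's `jac`. [cite: BoubakriGreuelMarkwig2010, §1] -/
def jac (p : ℕ) {n : ℕ} {κ : Type} [Field κ] (c : (Fin n → ℕ) → κ) : Ideal (MvPowerSeries (Fin n) κ) :=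
  Ideal.span (Set.range (fun i => pd i (ser p c)))

/-- **The mirror is exact**: the route decl `NoPeriodicIsolatedAtom` is, definitionally, the
following proposition over the mirrored operators (its `let`-block ζ-reduces onto the `def`s above;
the three predicates `Isol`, `MultP`, `PairIso` of the crux are displayed inline). [folklore] -/
theorem crux_iff :
    NoPeriodicIsolatedAtom ↔
      ∀ p : ℕ, p.Prime → ∀ n : ℕ, 0 < n → ∀ (κ : Type) [Field κ] [Algebra (ZMod p) κ] [Algebra.IsAlgebraic (ZMod p) κ]
        (c₀ : (Fin n → ℕ) → κ) (i : ℕ → Fin n) (t : ℕ → Fin n → κ) (r : ℕ), 0 < r →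
        (∀ m, m ≤ r →
          Module.Finite κ (MvPowerSeries (Fin n) κ ⧸ jac p (run p c₀ i t m)) ∧
          ((∃ A, clean p (run p c₀ i t m) A ≠ 0) ∧
            ∀ A, clean p (run p c₀ i t m) A ≠ 0 → p ≤ Finset.sum Finset.univ (fun j => A j))) →
        ¬ ∃ (φ : MvPowerSeries (Fin n) κ ≃ₐ[κ] MvPowerSeries (Fin n) κ) (v g : MvPowerSeries (Fin n) κ),
            IsUnit v ∧ φ (ser p (run p c₀ i t 0)) = v ^ p * ser p (run p c₀ i t r) + g ^ p :=
  Iff.rfl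

/-- The Whitney-umbrella start `x² y` over `𝔽₂` (`u₀ = x`, `u₁ = y`). -/
def umbrella : (Fin 2 → ℕ) → ZMod 2 := fun A => if A = ![2, 1] then 1 else 0

/-- The umbrella start is supported exactly on the exponent `(2, 1)`. [folklore] -/
lemma umbrella_ne_zero_iff (A : Fin 2 → ℕ) : umbrella A ≠ 0 ↔ A = ![2, 1] := by
  unfold umbrella
  by_cases h : A = ![2, 1] <;> simp [h]

/-- `x²y` is already `2`-clean (the exponent of `y` is odd). [folklore] -/
lemma clean_umbrella : clean 2 umbrella = umbrella := by
  funext A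
  unfold clean
  by_cases h : ∀ j, 2 ∣ A j
  · rw [if_pos h]
    by_cases hA : A = ![2, 1]
    · exact absurd (h 1) (by simp [hA])
    · simp [umbrella, hA]
  · rw [if_neg h]

/-- The order of `x²y` is `3`. [folklore] -/
lemma ord_umbrella : ord umbrella = 3 := by
  unfold ord
  have hset : {m : ℕ | ∃ A, umbrella A ≠ 0 ∧ m = Finset.sum Finset.univ (fun j => A j)} = {3} := by
    ext m
    simp only [Set.mem_setOf_eq, Set.mem_singleton_iff, umbrella_ne_zero_iff]
    constructor
    · rintro ⟨A, rfl, rfl⟩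
      simp [Fin.sum_univ_two]
    · rintro rfl
      exact ⟨![2, 1], rfl, by simp [Fin.sum_univ_two]⟩
  rw [hset, csInf_singleton]

/-- Blowing up in the `y`-chart (`x ↦ xy`) sends `x²y` to `x²y³`. [folklore] -/
lemma bl_umbrella : bl 1 umbrella = fun B => if B = ![2, 3] then 1 else 0 := by
  funext B
  unfold bl
  have hsum : Finset.sum (Finset.univ.erase (1 : Fin 2)) (fun j => B j) = B 0 := by
    have : (Finset.univ.erase (1 : Fin 2)) = {0} := by decide
    rw [this, Finset.sum_singleton]
  rw [hsum]
  by_cases hle : B 0 ≤ B 1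
  · rw [if_pos hle]
    unfold umbrella
    have key : (Function.update B 1 (B 1 - B 0) = ![2, 1]) ↔ B = ![2, 3] := by
      constructor
      · intro h
        have h0 := congrFun h 0
        have h1 := congrFun h 1
        simp [Function.update] at h0 h1
        funext j
        fin_cases j <;> simp <;> omega
      · intro h
        subst h
        funext j
        fin_cases j <;> simp [Function.update]
    by_cases hB : B = ![2, 3]
    · rw [if_pos (key.mpr hB), if_pos hB]
    · rw [if_neg (fun h => hB (key.mp h)), if_neg hB]
  · rw [if_neg hle]
    have hB : B ≠ ![2, 3] := by
      intro h; subst h; simp at hle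
    rw [if_neg hB]

/-- Dividing `x²y³` by `y²` gives back `x²y`. [folklore] -/
lemma dv_bl_umbrella : dv 1 2 (bl 1 umbrella) = umbrella := by
  rw [bl_umbrella]
  funext B
  unfold dv umbrella
  simp only []
  have key : (Function.update B 1 (B 1 + 2) = ![2, 3]) ↔ B = ![2, 1] := by
    constructor
    · intro h
      have h0 := congrFun h 0
      have h1 := congrFun h 1
      simp [Function.update] at h0 h1
      funext j
      fin_cases j <;> simp <;> omega
    · intro h
      subst h
      funext j
      fin_cases j <;> simp [Function.update]
  by_cases hB : B = ![2, 1]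
  · rw [if_pos (key.mpr hB), if_pos hB]
  · rw [if_neg (fun h => hB (key.mp h)), if_neg hB]

/-- Translating by `τ = 0` is the identity on `x²y`. [folklore] -/
lemma tr_zero_umbrella : tr 1 (0 : Fin 2 → ZMod 2) 2 umbrella = umbrella := by
  funext B
  unfold tr
  rw [Finset.sum_eq_single (0 : Fin 2 → ℕ)]
  · have hprod : Finset.prod (Finset.univ.erase (1 : Fin 2))
        (fun j => ((Nat.choose (B j + (0 : Fin 2 → ℕ) j) (B j) : ℕ) : ZMod 2) * (0 : Fin 2 → ZMod 2) j ^ ((0 : Fin 2 → ℕ) j)) = 1 := by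
      apply Finset.prod_eq_one
      intro j _
      simp
    rw [if_pos (show (0 : Fin 2 → ℕ) 1 = 0 from rfl), hprod, mul_one, add_zero]
  · intro D _ hD
    by_cases hD1 : D 1 = 0
    · rw [if_pos hD1]
      have hD0 : D 0 ≠ 0 := by
        intro h0
        apply hD
        funext j
        fin_cases j
        · exact h0
        · exact hD1
      have : Finset.prod (Finset.univ.erase (1 : Fin 2))
          (fun j => ((Nat.choose (B j + D j) (B j) : ℕ) : ZMod 2) * (0 : Fin 2 → ZMod 2) j ^ (D j)) = 0 := by
        apply Finset.prod_eq_zero (i := 0) (by decide)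
        simp [zero_pow hD0]
      rw [this, mul_zero]
    · rw [if_neg hD1]
  · intro h
    exact absurd (by simp [Fintype.mem_piFinset]) h

/-- **Fixed point**: one step of the dynamics (chart `y`, translation `0`) maps `x²y` to itself. [folklore] -/
lemma step_umbrella : step 2 1 (0 : Fin 2 → ZMod 2) umbrella = umbrella := by
  unfold step
  rw [clean_umbrella, ord_umbrella, if_pos (by norm_num : 2 ≤ 3), dv_bl_umbrella, tr_zero_umbrella,
    clean_umbrella]

/-- Hence the run from `x²y` along the constant chart `y` and zero translations is constant. [folklore] -/
lemma run_umbrella (m : ℕ) : run 2 umbrella (fun _ => 1) (fun _ _ => 0) m = umbrella := by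
  induction m with
  | zero => rfl
  | succ m ih =>
    show step 2 1 (0 : Fin 2 → ZMod 2) (run 2 umbrella (fun _ => 1) (fun _ _ => 0) m) = umbrella
    rw [ih, step_umbrella]

/-- `x²y` has multiplicity `2` (clean, non-zero, all monomials of degree `≥ 2`). [folklore] -/
lemma multP_umbrella :
    (∃ A, clean 2 umbrella A ≠ 0) ∧ ∀ A, clean 2 umbrella A ≠ 0 → 2 ≤ Finset.sum Finset.univ (fun j => A j) := by
  rw [clean_umbrella]
  refine ⟨⟨![2, 1], by simp [umbrella]⟩, ?_⟩
  intro A hA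
  rw [umbrella_ne_zero_iff] at hA
  subst hA
  simp [Fin.sum_univ_two]

/-- `PairIso` is reflexive (`φ = id`, `v = 1`, `g = 0`). [folklore] -/
lemma pairIso_refl {n : ℕ} {κ : Type} [Field κ] (p : ℕ) (hp : p ≠ 0) (c : (Fin n → ℕ) → κ) :
    ∃ (φ : MvPowerSeries (Fin n) κ ≃ₐ[κ] MvPowerSeries (Fin n) κ) (v g : MvPowerSeries (Fin n) κ),
      IsUnit v ∧ φ (ser p c) = v ^ p * ser p c + g ^ p :=
  ⟨AlgEquiv.refl, 1, 0, isUnit_one, by simp [zero_pow hp]⟩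

/-- **`Isol` is load-bearing in `NoPeriodicIsolatedAtom`.** The proposition below is the right-hand
side of `crux_iff` with the isolatedness conjunct `Module.Finite κ (κ[[u]] ⧸ jac …)` deleted and
nothing else changed; it is false: the Whitney umbrella `z² = x²y` over `𝔽₂` is a literal fixed point of the
chart-`y` step at translation `0`, of multiplicity `2` throughout, and `PairIso` is reflexive.
Any proof of the crux must use `Isol`. [cite: HauserPerlega2019, §1 p. 3 (cycles are easy once the
choice of centres is not forced)] -/
theorem noPeriodicIsolatedAtom_false_without_Isol :
    ¬ ∀ p : ℕ, p.Prime → ∀ n : ℕ, 0 < n → ∀ (κ : Type) [Field κ] [Algebra (ZMod p) κ] [Algebra.IsAlgebraic (ZMod p) κ]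
        (c₀ : (Fin n → ℕ) → κ) (i : ℕ → Fin n) (t : ℕ → Fin n → κ) (r : ℕ), 0 < r →
        (∀ m, m ≤ r →
          ((∃ A, clean p (run p c₀ i t m) A ≠ 0) ∧
            ∀ A, clean p (run p c₀ i t m) A ≠ 0 → p ≤ Finset.sum Finset.univ (fun j => A j))) →
        ¬ ∃ (φ : MvPowerSeries (Fin n) κ ≃ₐ[κ] MvPowerSeries (Fin n) κ) (v g : MvPowerSeries (Fin n) κ),
            IsUnit v ∧ φ (ser p (run p c₀ i t 0)) = v ^ p * ser p (run p c₀ i t r) + g ^ p := by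
  intro h
  have key := h 2 Nat.prime_two 2 two_pos (ZMod 2) umbrella (fun _ => 1) (fun _ _ => 0) 1 one_pos
    (fun m _ => by rw [run_umbrella]; exact multP_umbrella)
  apply key
  rw [run_umbrella, run_umbrella]
  exact pairIso_refl 2 two_ne_zero umbrella

end Summit.ResolutionOfSingularities.ResolutionOfSingularities.Theorems.NoPeriodicIsolatedAtom.Negative

end
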